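import Literature.NumberTheory.EllipticCurves.Castella2018.ErratumHidaMembersCongruenceTorsionFree
import Literature.NumberTheory.EllipticCurves.SkinnerUrban2014.GL2MainConjecture
import Literature.NumberTheory.EllipticCurves.BDPAnticyclotomicPAdicLFunctionSigmaInt
import HarnessLib

/-!
# Castella's erratum, proof of Thm. 1.1 (p. 4), the PUBLISHED member data WITH FRAMES: the `R₀`-frame of `f` [Cas18 Thm. 3.1], Hida
# members `g_m` (a)+(b) [Ski16 §2.6] with footnote 1's residual properties and the rigid Steinberg sign, and their Σ-imprimitive
# `p`-adic `L`-functions `L^Σ_p(g_m) ∈ 𝓞_{ℂ_p}⟦T⟧` for the SAME CM periods, congruent to `L^Σ_p(f)` mod `p^m` [Cas20 Thm. 2.11, Cas18 (4.1)]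

Cell `bsd-stepL` (run/shared/lean/pub/bsd-stepL/), seat `bsd-stepL-imc-p1` (prover g15, 2026-08-28); design memo
`HOME/imc-p1/g15/FSPLIT-DESIGN-20529-imc-p1-g15.md` (evidence on item stmt-BirchSwinnertonDyer-20529), fact F3♯. ONE new named `Prop`
(D-0014: +1 unproved; a CONJUNCTION of published results, each cited) ; no definition besides the `Prop`, no instance, no `sorry`.

## Why this file exists

Companion of `ErratumThm23UpperDivisibility.lean` (F4♯, the OPEN one-newform statement «⊂» of erratum Thm. 2.3). The tree's member
package O15 (`erratum_members_exists_charIdeal_le_of_isTorsion_congruence_OPEN`) = {frame of `f`, members, (2.5)_m, (c)} with `L^Σ_p(g_m)`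
existential. Splitting off (2.5)_m as F4♯ requires the REMAINING, published part to name the member's `L^Σ_p(g_m)` — now possible in the
receptacle `𝓞_{ℂ_p}⟦T⟧` with the Σ-imprimitive weight-`k` frame `IsBDPLFunctionWtSigmaInt` (file `BDPAnticyclotomicPAdicLFunctionSigmaInt.lean`)
— and to carry the member-level printed properties that F4♯'s hypotheses (i′), (iii), (iv) ask of `g_m` (erratum footnote 1 and the
rigidity of automorphic types), which the tree's `Skinner2016.HidaCongruentMember` does not record (it records `a_ℓ(g_m) ≡ a_ℓ(E)` at
`ℓ ∤ N` only). The cell's kernel glue (`HOME/imc-p1/g15/FSplitScratch.lean`, farm-checked: `P2.RoadFF.fittingCongruenceFrameAtErratumDataB_of_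
thm23_OPEN_of_cas20`) derives the K2 crux `IMCDivAtErratumDataAllR` from F4♯ + this fact + theorems of the tree.

## Source, verbatim

[Castella2018Erratum] proof of Thm. 1.1 (p. 4): "Put `M = N` if `p ∤ N`, and `M = N/p` if `p ∥ N`. … We claim that, after possibly
enlarging `𝒪`, for each `m ≥ 1` there exists (a) a `p`-ordinary newform `g_m ∈ S_{k_m}(Γ₀(M))` defined over `𝒪` of weight `k_m > 2` with
`k_m ≡ 2 (mod p − 1)`; (b) a `G_ℚ`-stable lattice `T_{g_m} ⊂ V_{g_m}` and an isomorphism `T_{g_m}/p^m T_{g_m} ≃ T/p^m T` as `𝒪[G_ℚ]`-modules;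
(c) an equality `(L^Σ_p(g_m), p^m) = (L^Σ_p(f), p^m) ⊂ Λ_𝒪^ur`. Indeed, (a) and (b) follow from Hida theory (see the discussion in [Ski16,
§2.6]), and (c) follows from [Cas20, Thm. 2.11]." Footnote 1: "the hypothesis that `ρ̄_{g_m} ≃ E[p]` is irreducible as a `G_ℚ`-module and
ramified at some prime `q ∥ N` nonsplit in `K` implies that `ρ̄_{g_m}|_{G_K}` is irreducible, see [Ski20, Lem. 2.8.1]. Moreover, by
'rigidity of automorphic types' [FO12, Lem. 2.14], condition (iii) in Theorem 1.1 implies conditions (iii) and (iv) in Theorem 2.3."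
[Castella2020JIMJ] Thm. 2.11 (p. 12): "Let `ν ∈ 𝒳_𝒪(𝕀)` of weight `(k, 𝟙)` with `k ≥ 1` be such that `𝐟_ν` is classical … Then
`ν(ℒ_{𝔭,ξ}(𝐟))(φ̂)² / Ω_p^{2k+4ℓ} = L^alg(f_ν/K, χ_νξ_νφ, k_ν − 1) · 𝓔_𝔭(f_ν, χ_νξ_νφ)² · φ(𝔑⁻¹) · 2³ · c_o ε(f_ν) · w_K² √D_K`, where …
`Ω_p ∈ 𝒲^×` is a `p`-adic period as in [CH18, §2.5]" (the SAME CM periods `(Ω_K, Ω_p)` at every `ν`); Rem. 2.12: "the `L`-values appearing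
in Theorem 2.11 are central critical values". [Castella2018] Thm. 3.1 (the `R₀`-frame `L_p(f) ∈ Λ_{R₀}`, tree `IsBDPLFunction` ∕
`castella2018_exists_isBDPLFunction`), (3.1) (`L^Σ_p(f) := L_p(f) × ∏_{w∈Σ} P_w(…)`), (4.1) and p. 11 L9–11: "the proof of [Cas14 = Cas20,
Thm. 2.11] shows that `L_p(𝐟)` reduces to `L_p(𝐟_φ)` modulo `℘̃_φ` for all `φ ∈ 𝒳^a_𝕀` … the specialization property (4.1)
[`L^Σ_p(𝐟) mod ℘̃_φ = L^Σ_p(𝐟_φ)`] thus follows." [Skinner2016PacificMC] §2.6 (2-6-1) (members `φ_{k'} ≡ φ_0 (mod p^m 𝒪)` on `𝕀`; tree F2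
`Skinner2016.HidaCongruentMember`, fact `skinner2016_exists_hidaCongruentMember`). [JetchevSkinnerWan2017] §5.1 (tex p0022 L41–50): the
Σ-imprimitive `p`-adic `L`-function "satisfies the interpolation formula … with `L(f,ψ^alg,1)` replaced with the incomplete `L`-value
`L^Σ(f,ψ^alg,1)`".

## Transcription (tree vocabulary only; nothing re-declared)

Binders = O15's `E`-level binders (W globally minimal with newform `f` of level `N`, `3 < p`, `Mult W p`, `3 ≤ N/p`, `Irr W p`; `K` imaginary
quadratic, Heegner for `N`, `p` split, `𝔭 ∋ p` via `ι`; `κ` anticyclotomic with generator `γ`) PLUS the erratum's (iii)-witness `q`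
(`Mult W q`, `q` non-split in `K`, `E[p]` ramified at `q`: `¬ p ∣ v_q(Δ_min)`) and [Cas20 §2.5]'s `d_K` odd, PLUS characterised
receptacle maps `a : R₀ → 𝓞_{ℂ_p}` (the inclusion) and `j : ℤ_p → R₀` (the structure map), as in O15's receptacle clause.
CONCLUSION: THERE ARE `Ω_K ≠ 0`, `Ω_p ∈ R₀^×`, `L ∈ R₀⟦T⟧` with `IsBDPLFunction ι 𝔭 κ γ f Ω_K Ω_p L` [Cas18 Thm. 3.1 frame of `f`] and,
for every `m ≥ 1`, a member `D : Skinner2016.HidaCongruentMember W p m` [(a)+(b)] and `Q_m ∈ 𝓞_{ℂ_p}⟦T⟧` such that: the member's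
coefficient embedding `D.ι` is COMPATIBLE with the fixed embedding datum, `ι (D.ι x) = x` on `ℚ(g_m) ⊂ ℂ` (print fixes ONE `ı_p`; "`g_m` …
defined over `𝒪`" — flag `MF-compat`; without it the frame of `D.g` read via `ι` and the Galois datum `D.Δ` read via `D.ι` would be
uncorrelated); `SkinnerUrban2014.IsResiduallyIrreducible D.Δ` and `D.Δ` residually ramified at `q` [footnote 1: `ρ̄_{g_m} ≃ E[p]`],
`a_ℓ(g_m) = −ℓ^{k_m/2−1}` at every prime `ℓ ∣ N/p` non-split in `K` [rigidity, FO12 L.2.14: `π(g_m)_ℓ` special ⊗ (`ℓ ↦ −ℓ^{k/2−1}`)],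
`IsBDPLFunctionWtSigmaInt ι 𝔭 κ γ D.g Σ(W,p)(K) Ω_K Ω_p Q_m` [`Q_m = L^Σ_p(g_m)` for the SAME periods, Cas20 Thm. 2.11 + JSW17 §5.1], and
(c) `(Q_m) + (p^m) = (a(L·j(P_Σ))) + (p^m)` in `𝓞_{ℂ_p}⟦T⟧` [`L^Σ_p(f) = L_p(f)·P_Σ`, Cas18 (3.1); `P_Σ = W.sigmaEulerElement p K κ`].

## Flags (nothing hidden; each makes the `Prop` WEAKER than or equal to the printed chain)

* `MF-compat`: the clause `∀ x, ι (D.ι x) = x` records that the member's `p`-adic data (lattice, `ρ_{g_m}`, ordinarity, `L^Σ_p(g_m)`) are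
  taken w.r.t. THE fixed embedding `ı_p = ι⁻¹`, as everywhere in print; it is what lets a consumer pair the member's Galois side with its
  analytic side (reviewer of the companion F4♯, p590900).
* `MF-chain`: a CONJUNCTION of published statements ([Cas18 3.1], [Ski16 2.6], [Ski20 2.8.1] + Carayol rigidity of the residual
  representation, [FO12 2.14], [Cas20 2.11] + [Cas18 (4.1)/p. 11], [JSW17 §5.1]) exactly as the erratum's proof of Thm. 1.1 assembles them;
  cited link by link; not a single printed display.
* `MF-sp-factor` (= LIT-DOSSIER §20.4 `HF-sp-factor`): the identification `φ_f(L_p(𝐟)) ∼ L_p(f)` at the `p`-NEW weight-2 point behind (c)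
  is [Cas18, p. 11 L9–11] by reference to the proof of [Cas20, Thm. 2.11] (no separate display); the consumer uses only `(Q_m) ⊆ (L^Σ_f) + (p^m)`.
* `MF-receptacle`: print's `Λ_𝒪^ur`; here `Q_m ∈ 𝓞_{ℂ_p}⟦T⟧ ⊇ (R₀·𝒪_m)⟦T⟧` (the member's function read in `𝓞_{ℂ_p}`), `a`, `j` characterised.
* `MF-sigma-interp`, `MF-periods`: `L^Σ_p(g_m)` characterised by Σ-depleted interpolation in D3's normalisation with the SAME `(Ω_K, Ω_p)`
  as `f`'s frame (Cas20 Thm. 2.11); a unit of normalisation does not change the ideals in (c).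
* `MF-own-ring` ∕ `MF-per-m` ∕ `MF-A-side`: as F2 ∕ O15 (`∀ m ∃` member over its own `𝒪_m`).
* `MF-footnote`: the residual irreducibility ∕ ramification of `ρ̄_{g_m}` and the Steinberg sign at non-split `ℓ ∣ M` are RECORDED as printed
  consequences (footnote 1) rather than derived in the kernel from (b).
STATUS: **PUB chain** — every link refereed ([Cas18], [Cas20], [Ski16], [Ski20], [FO12], [JSW17], [CH18]); the erratum sentence assembling
them is unrefereed but asserts nothing beyond the links. Take as a hypothesis; discharging it = typing Hida theory and the BDP measures.

## References

* [Castella2018Erratum] proof of Thm. 1.1, (a)(b)(c) and footnote 1 (p. 4). [Castella2020JIMJ] J. Inst. Math. Jussieu 19 (2020), §2.5,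
  Def. 2.10, Thm. 2.11, Rem. 2.12. [Castella2018] Camb. J. Math. 6 (2018), Thm. 3.1, (3.1) (p. 9), Thm. 4.2 (4.1) and p. 11 L9–11.
* [Skinner2016PacificMC] §2.6 (2-6-1), §3.1 (a)(b) (p. 192). [Skinner2020] Lem. 2.8.1. [FouquetOchiai2012] Lem. 2.14. [Carayol1994] Thm. 1.
* [JetchevSkinnerWan2017] §5.1 (arXiv:1512.06894 tex p0022 L41–50). [CastellaHsieh2018] §2.5, Def. 3.7, Prop. 3.8.
* Tree: `Skinner2016/HidaCongruentMembers.lean` (F2), `BDPAnticyclotomicPAdicLFunction(SigmaInt).lean`, `SigmaEulerData.lean`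
  (`sigmaPlacesFinset`, `sigmaEulerElement`), `SkinnerUrban2014/GL2MainConjecture.lean` (residual predicates), O15.
-/

noncomputable section

open scoped Classical

open PowerSeries WeierstrassCurve NumberField IsDedekindDomain Field
  Literature.NumberTheory.EllipticCurves Literature.NumberTheory.EllipticCurves.ModularForms
  Literature.NumberTheory.EllipticCurves.Rank1Residual Literature.NumberTheory.EllipticCurves.BigGaloisRep
  Literature.NumberTheory.EllipticCurves.GreenbergSelmer Literature.NumberTheory.GaloisRepresentations

namespace Literature.NumberTheory.EllipticCurves.Castella2018

/-- ⚠ RETURNED MISSTATED (refuter `bsd-vet-utdR2` g0, 2026-08-28): the first half of the erratum's print hypothesis (iii) is missing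
and the `Prop` is FALSE as stated (split multiplicative `ℓ ∣ M` not split in `K`; witness `55a1`, `p = 11`, `K = ℚ(√−35)`); NEVER cite
it — use the print-faithful re-type `erratum_exists_frames_members_sigma_congruence_nonsplit` below (same text + (iii)).
**Castella's erratum, proof of Thm. 1.1 — the PUBLISHED member data with frames: the `R₀`-frame of `f` [Cas18 Thm. 3.1]; for every
`m ≥ 1` a Hida member `g_m` [Ski16 §2.6 (a)(b)] whose residual representation `≃ E[p]` is irreducible and ramified at the non-split
witness `q` [footnote 1] and whose Steinberg sign at every `ℓ ∣ M` non-split in `K` is `−ℓ^{k_m/2−1}` [FO12 L.2.14]; and its Σ-imprimitive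
`p`-adic `L`-function `Q_m = L^Σ_p(g_m) ∈ 𝓞_{ℂ_p}⟦T⟧` for the SAME CM periods with (c) `(L^Σ_p(g_m)) + (p^m) = (L^Σ_p(f)) + (p^m)`
[Cas20 Thm. 2.11, Cas18 (3.1)∕(4.1)].** Binders, transcription and the flags `MF-compat`, `MF-chain`, `MF-sp-factor`, `MF-receptacle`,
`MF-sigma-interp`, `MF-periods`, `MF-own-ring`, `MF-per-m`, `MF-A-side`, `MF-footnote`: module docstring. A conjunction of published results (D-0014);
nothing about `p`-adic `L`-functions is constructed here.
[cite: Castella2018Erratum, proof of Thm. 1.1 (a)(b)(c) and footnote 1 (p. 4) (the chain, as assembled there)]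
[cite: Castella2020JIMJ, Def. 2.10, Thm. 2.11 and Rem. 2.12 ((c): the two-variable `ℒ_{𝔭,ξ}(𝐟)` with fixed CM periods)]
[cite: Castella2018, Thm. 3.1, (3.1) (p. 9), (4.1) and p. 11 L9–11 (frame of `f`; `L^Σ`; specialisation)]
[cite: Skinner2016PacificMC, §2.6 (2-6-1) and §3.1 (a)(b) (p. 192) (members)]
[cite: Skinner2020, Lem. 2.8.1 (footnote 1: residual irreducibility over `K`)]
[cite: FouquetOchiai2012, Lem. 2.14 (rigidity of automorphic types: (iii) ⇒ (iii)+(iv) of Thm. 2.3 for the members)]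
[cite: JetchevSkinnerWan2017, §5.1 (arXiv:1512.06894 tex p0022 L41–50) (Σ-imprimitive interpolation)] -/
def erratum_exists_frames_members_sigma_congruence : Prop :=
  ∀ {p : ℕ} [Fact p.Prime] (ι : PadicAlgCl p ≃+* ℂ) (W : WeierstrassCurve ℚ) [W.IsElliptic]
    [W.IsGloballyMinimal] (K : Type) [Field K] [NumberField K]
    (𝔭 : HeightOneSpectrum (𝓞 K)) (κ : ZpExtension K p) (γ : absoluteGaloisGroup K)
    [Fact (κ.IsTopGenerator γ)] {N : ℕ} [NeZero N] {f : CuspForm (CongruenceSubgroup.Gamma0 N) 2}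
    (_ : IsNewformOf W f) (q : ℕ) [Fact q.Prime],
    -- "`E/ℚ` … of conductor `N` with multiplicative reduction at `p > 3`", `M = N/p ≥ 3`, (i) `E[p]` irreducible
    W.conductorNorm ℤ = N → 3 < p → Mult W p → 3 ≤ N / p → Irr W p →
    -- the (iii)-witness `q`: multiplicative, non-split in `K`, `E[p]` ramified at `q`
    Mult W q → ((Ideal.span {(q : ℤ)}).primesOver (𝓞 K)).ncard ≠ 2 → ¬ p ∣ padicValInt q W.minimalDiscriminantInt →
    -- `K` imaginary quadratic, `d_K` odd [Cas20 §2.5], Heegner for `N`, `p = 𝔭𝔭̄` split, `𝔭` via `ι`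
    IsImaginaryQuadratic K → Odd (NumberField.discr K) → (∃ β : ℤ, (4 * N : ℤ) ∣ β ^ 2 - NumberField.discr K) →
    ((Ideal.span {(p : ℤ)}).primesOver (𝓞 K)).ncard = 2 →
    ((p : ℕ) : 𝓞 K) ∈ 𝔭.asIdeal →
    (∀ (w : InfinitePlace K) (x : 𝓞 K), x ∈ 𝔭.asIdeal ↔ ‖ι.symm (w.embedding (x : K))‖ < 1) →
    -- `Γ` THE anticyclotomic `ℤ_p`-extension
    κ.IsAnticyclotomic →
    -- receptacle maps: `a : R₀ ⊆ 𝓞_{ℂ_p}` the inclusion, `j : ℤ_p → R₀` the structure map (characterised)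
    ∀ (a : unrIntegers p →+* PadicComplexInt p) (j : ℤ_[p] →+* unrIntegers p),
      (∀ x : unrIntegers p, ((a x : PadicComplexInt p) : ℂ_[p]) = (x : ℂ_[p])) →
      (∀ x : ℤ_[p], ((j x : unrIntegers p) : ℂ_[p]) = algebraMap ℚ_[p] ℂ_[p] (x : ℚ_[p])) →
    -- THEN: an `R₀`-frame of `f` at `(ι, 𝔭)` [Cas18 Thm. 3.1] …
    ∃ (ΩK : ℂ) (Ωp : (unrIntegers p)ˣ) (L : UnrSeries p),
      ΩK ≠ 0 ∧ IsBDPLFunction ι 𝔭 κ γ f ΩK ((Ωp : unrIntegers p) : ℂ_[p]) L ∧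
      -- … and for every `m ≥ 1` a member (a)+(b) with its printed properties and its Σ-imprimitive `p`-adic `L`-function
      ∀ m : ℕ, 1 ≤ m →
        ∃ (D : Skinner2016.HidaCongruentMember W p m) (Qm : PowerSeries (PadicComplexInt p)),
          -- the member's `p`-adic coefficient embedding IS the fixed `ı_p = ι⁻¹` on `ℚ(g_m) ⊂ ℂ` ("defined over `𝒪`"; flag `MF-compat`)
          (∀ x : coeffField D.g, ι (D.ι x) = (x : ℂ)) ∧
          -- footnote 1: `ρ̄_{g_m} ≃ E[p]` is irreducible and ramified at `q`
          SkinnerUrban2014.IsResiduallyIrreducible D.Δ ∧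
          (∃ v : HeightOneSpectrum (𝓞 ℚ), ((Rat.HeightOneSpectrum.primesEquiv v : Nat.Primes) : ℕ) = q ∧
            SkinnerUrban2014.IsResiduallyRamifiedAt D.Δ v) ∧
          -- rigidity of automorphic types [FO12 L.2.14]: `π(g_m)_ℓ` special ⊗ (`ℓ ↦ −ℓ^{k_m/2−1}`) at every `ℓ ∣ M` non-split in `K`
          (∀ ℓ : ℕ, ℓ.Prime → ℓ ∣ N / p → ((Ideal.span {(ℓ : ℤ)}).primesOver (𝓞 K)).ncard ≠ 2 →
            (UpperHalfPlane.qExpansion 1 ⇑D.g).coeff ℓ = -((ℓ : ℂ) ^ (D.k / 2 - 1).toNat)) ∧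
          -- `Q_m = L^Σ_p(g_m)`: the Σ-imprimitive frame of `g_m` for the SAME periods [Cas20 Thm. 2.11, JSW17 §5.1]
          IsBDPLFunctionWtSigmaInt ι 𝔭 κ γ D.g (W.sigmaPlacesFinset p K) ΩK ((Ωp : unrIntegers p) : ℂ_[p]) Qm ∧
          -- (c): `(L^Σ_p(g_m), p^m) = (L^Σ_p(f), p^m)`, `L^Σ_p(f) = L_p(f)·P_Σ` [Cas18 (3.1)], read in `𝓞_{ℂ_p}⟦T⟧`
          Ideal.span {Qm} ⊔ Ideal.span {(PowerSeries.C (((p : ℕ) : PadicComplexInt p) ^ m))} =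
            Ideal.span {PowerSeries.map a (L * PowerSeries.map j (W.sigmaEulerElement p K κ))} ⊔
              Ideal.span {(PowerSeries.C (((p : ℕ) : PadicComplexInt p) ^ m))}

/-- **Print-faithful RE-TYPE (vet repair C′) of `erratum_exists_frames_members_sigma_congruence` (F3♯): the same conjunction of
published results — the `R₀`-frame of `f` [Cas18 Thm. 3.1], members `g_m` [Ski16 §2.6 (a)(b)] with `ρ̄_{g_m} ≃ E[p]` irreducible and
ramified at the non-split witness `q` [footnote 1], the rigid Steinberg sign at every `ℓ ∣ M` non-split in `K` [FO12 L.2.14], the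
Σ-imprimitive frames for the SAME CM periods and (c) [Cas20 Thm. 2.11, Cas18 (3.1)/(4.1)] — WITH the erratum's printed hypothesis (iii),
first half: "`E` has nonsplit multiplicative reduction at each prime `q ∥ N` which is nonsplit in `K`" ([Castella2018Erratum] Thm. 1.1
(iii); verbatim in arXiv:2409.01360 Thm. 1.3 (iii) / Thm. 3.1 (iii), read p. 3 and p. 8), inserted after `Irr W p` in the tree's erratum
spelling `∀ ℓ, Mult W ℓ → #{𝔩 ∣ ℓ} ≠ 2 → ¬ W.HasSplitMultiplicativeReductionAtPrime ℓ` (the second half, "there is at least one such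
prime `q` at which `E[p]` is ramified", is the witness `q` already among the binders).**  WHY: the erratum's footnote 1 derives the
members' Steinberg sign FROM (iii) ("by 'rigidity of automorphic types' [FO12, Lem. 2.14], condition (iii) in Theorem 1.1 implies
conditions (iii) and (iv) in Theorem 2.3"); the original decl above omits the first half of (iii) and is FALSE as stated (refuter
`bsd-vet-utdR2` g0, 2026-08-28, memo `pub/bsd-wall/bsd-vet-utdR2/VET-UTDR2-g0.md`, witness (W2): `E = 55a1`, `p = 11`, `K = ℚ(√−35)`,
`q = ℓ = 5 ∣ M` SPLIT multiplicative and ramified in `K`, `11 ∤ v₅(Δ)`: `T_{g_m}/p^m ≃ T_pE/p^m` forces `a₅(g_m) = +5^{k/2−1}` for every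
member). Under (iii), `a_ℓ(E) = −1` at these `ℓ` and members of weight `k = 2 + (p−1)p^{m−1}t`, `t` even, carry the printed sign.
All binders, the transcription and the flags `MF-compat`, `MF-chain`, `MF-sp-factor`, `MF-receptacle`, `MF-sigma-interp`, `MF-periods`,
`MF-own-ring`, `MF-per-m`, `MF-A-side`, `MF-footnote` are those of the original (module docstring); the one change is the added
hypothesis (a WEAKER `Prop`). A conjunction of published results (D-0014); nothing about `p`-adic `L`-functions is constructed here. The
original decl is kept (append protocol; dependents — bsd-stepL's K2 glue, UTD 23594's F3♯ stub — are re-keyed by their stewards).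
[cite: Castella2018Erratum, Thm. 1.1 hypothesis (iii) and footnote 1, proof of Thm. 1.1 (a)(b)(c) (p. 4)]
[cite: Castella2020JIMJ, Def. 2.10, Thm. 2.11 and Rem. 2.12 ((c): the two-variable `ℒ_{𝔭,ξ}(𝐟)` with fixed CM periods)]
[cite: Castella2018, Thm. 3.1, (3.1) (p. 9), (4.1) and p. 11 L9–11 (frame of `f`; `L^Σ`; specialisation)]
[cite: Skinner2016PacificMC, §2.6 (2-6-1) and §3.1 (a)(b) (p. 192) (members)]
[cite: Skinner2020, Lem. 2.8.1 (footnote 1: residual irreducibility over `K`)]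
[cite: FouquetOchiai2012, Lem. 2.14 (rigidity of automorphic types: (iii) ⇒ (iii)+(iv) of Thm. 2.3 for the members)]
[cite: JetchevSkinnerWan2017, §5.1 (arXiv:1512.06894 tex p0022 L41–50) (Σ-imprimitive interpolation)] -/
def erratum_exists_frames_members_sigma_congruence_nonsplit : Prop :=
  ∀ {p : ℕ} [Fact p.Prime] (ι : PadicAlgCl p ≃+* ℂ) (W : WeierstrassCurve ℚ) [W.IsElliptic]
    [W.IsGloballyMinimal] (K : Type) [Field K] [NumberField K]
    (𝔭 : HeightOneSpectrum (𝓞 K)) (κ : ZpExtension K p) (γ : absoluteGaloisGroup K)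
    [Fact (κ.IsTopGenerator γ)] {N : ℕ} [NeZero N] {f : CuspForm (CongruenceSubgroup.Gamma0 N) 2}
    (_ : IsNewformOf W f) (q : ℕ) [Fact q.Prime],
    -- "`E/ℚ` … of conductor `N` with multiplicative reduction at `p > 3`", `M = N/p ≥ 3`, (i) `E[p]` irreducible
    W.conductorNorm ℤ = N → 3 < p → Mult W p → 3 ≤ N / p → Irr W p →
    -- PRINT HYPOTHESIS (iii), first half, of the erratum's Thm. 1.1 (= arXiv:2409.01360 Thm. 1.3 / Thm. 3.1): "`E` has nonsplit
    -- multiplicative reduction at each prime `q ∥ N` which is nonsplit in `K`" — the tree's erratum spelling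
    -- (`erratumThm11_exists_isBDPLFunction_isTorsion_charIdeal_eq_OPEN`); by footnote 1 it is the printed source of the
    -- Steinberg-sign conjunct of the conclusion [FO12 L.2.14]; ABSENT from the vet-returned original above
    (∀ (ℓ : ℕ) [Fact ℓ.Prime], Mult W ℓ → ((Ideal.span {(ℓ : ℤ)}).primesOver (𝓞 K)).ncard ≠ 2 →
      ¬ W.HasSplitMultiplicativeReductionAtPrime ℓ) →
    -- the (iii)-witness `q`: multiplicative, non-split in `K`, `E[p]` ramified at `q`
    Mult W q → ((Ideal.span {(q : ℤ)}).primesOver (𝓞 K)).ncard ≠ 2 → ¬ p ∣ padicValInt q W.minimalDiscriminantInt →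
    -- `K` imaginary quadratic, `d_K` odd [Cas20 §2.5], Heegner for `N`, `p = 𝔭𝔭̄` split, `𝔭` via `ι`
    IsImaginaryQuadratic K → Odd (NumberField.discr K) → (∃ β : ℤ, (4 * N : ℤ) ∣ β ^ 2 - NumberField.discr K) →
    ((Ideal.span {(p : ℤ)}).primesOver (𝓞 K)).ncard = 2 →
    ((p : ℕ) : 𝓞 K) ∈ 𝔭.asIdeal →
    (∀ (w : InfinitePlace K) (x : 𝓞 K), x ∈ 𝔭.asIdeal ↔ ‖ι.symm (w.embedding (x : K))‖ < 1) →
    -- `Γ` THE anticyclotomic `ℤ_p`-extension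
    κ.IsAnticyclotomic →
    -- receptacle maps: `a : R₀ ⊆ 𝓞_{ℂ_p}` the inclusion, `j : ℤ_p → R₀` the structure map (characterised)
    ∀ (a : unrIntegers p →+* PadicComplexInt p) (j : ℤ_[p] →+* unrIntegers p),
      (∀ x : unrIntegers p, ((a x : PadicComplexInt p) : ℂ_[p]) = (x : ℂ_[p])) →
      (∀ x : ℤ_[p], ((j x : unrIntegers p) : ℂ_[p]) = algebraMap ℚ_[p] ℂ_[p] (x : ℚ_[p])) →
    -- THEN: an `R₀`-frame of `f` at `(ι, 𝔭)` [Cas18 Thm. 3.1] …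
    ∃ (ΩK : ℂ) (Ωp : (unrIntegers p)ˣ) (L : UnrSeries p),
      ΩK ≠ 0 ∧ IsBDPLFunction ι 𝔭 κ γ f ΩK ((Ωp : unrIntegers p) : ℂ_[p]) L ∧
      -- … and for every `m ≥ 1` a member (a)+(b) with its printed properties and its Σ-imprimitive `p`-adic `L`-function
      ∀ m : ℕ, 1 ≤ m →
        ∃ (D : Skinner2016.HidaCongruentMember W p m) (Qm : PowerSeries (PadicComplexInt p)),
          -- the member's `p`-adic coefficient embedding IS the fixed `ı_p = ι⁻¹` on `ℚ(g_m) ⊂ ℂ` ("defined over `𝒪`"; flag `MF-compat`)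
          (∀ x : coeffField D.g, ι (D.ι x) = (x : ℂ)) ∧
          -- footnote 1: `ρ̄_{g_m} ≃ E[p]` is irreducible and ramified at `q`
          SkinnerUrban2014.IsResiduallyIrreducible D.Δ ∧
          (∃ v : HeightOneSpectrum (𝓞 ℚ), ((Rat.HeightOneSpectrum.primesEquiv v : Nat.Primes) : ℕ) = q ∧
            SkinnerUrban2014.IsResiduallyRamifiedAt D.Δ v) ∧
          -- rigidity of automorphic types [FO12 L.2.14]: `π(g_m)_ℓ` special ⊗ (`ℓ ↦ −ℓ^{k_m/2−1}`) at every `ℓ ∣ M` non-split in `K`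
          (∀ ℓ : ℕ, ℓ.Prime → ℓ ∣ N / p → ((Ideal.span {(ℓ : ℤ)}).primesOver (𝓞 K)).ncard ≠ 2 →
            (UpperHalfPlane.qExpansion 1 ⇑D.g).coeff ℓ = -((ℓ : ℂ) ^ (D.k / 2 - 1).toNat)) ∧
          -- `Q_m = L^Σ_p(g_m)`: the Σ-imprimitive frame of `g_m` for the SAME periods [Cas20 Thm. 2.11, JSW17 §5.1]
          IsBDPLFunctionWtSigmaInt ι 𝔭 κ γ D.g (W.sigmaPlacesFinset p K) ΩK ((Ωp : unrIntegers p) : ℂ_[p]) Qm ∧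
          -- (c): `(L^Σ_p(g_m), p^m) = (L^Σ_p(f), p^m)`, `L^Σ_p(f) = L_p(f)·P_Σ` [Cas18 (3.1)], read in `𝓞_{ℂ_p}⟦T⟧`
          Ideal.span {Qm} ⊔ Ideal.span {(PowerSeries.C (((p : ℕ) : PadicComplexInt p) ^ m))} =
            Ideal.span {PowerSeries.map a (L * PowerSeries.map j (W.sigmaEulerElement p K κ))} ⊔
              Ideal.span {(PowerSeries.C (((p : ℕ) : PadicComplexInt p) ^ m))}

/-! ### Readers (PROVED): discharging the erratum's hypothesis (iii) for the consumers of the re-typed facts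

The print hypothesis (iii), first half — "`E` has nonsplit multiplicative reduction at each prime `q ∥ N` which is nonsplit in
`K`" [Castella2018Erratum Thm. 1.1 (iii) = arXiv:2409.01360 Thm. 1.3 (iii), p. 3] — is the binder
`∀ q, Mult W q → #{𝔮 ∣ q} ≠ 2 → ¬ W.HasSplitMultiplicativeReductionAtPrime q` of `erratum_exists_frames_members_sigma_congruence_nonsplit`
(above) and of `castella2020_thm211_members_frames_sigma_congruence_odd_nonsplit` (sibling file
`HidaMembersFramesSigmaCongruenceOddPrime.lean`). The two lemmas below are the discharges the consumers of record need (no new fact;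
bookkeeping over Silverman 1994 IV.10.2(a) "a multiplicative prime divides the conductor", tree
`dvd_conductorNorm_iff_not_hasGoodReductionAtPrime`): (1) at an ALL-SPLIT `K` (classical Heegner hypothesis, the UTD consumer) the
binder is vacuous; (2) when the only multiplicative prime of `E` not split in `K` is ONE witness prime `q₀` at which `E` is nonsplit
multiplicative (the ramified-witness consumers, e.g. route `ErratumRoadFive`), the binder reduces to that one prime. -/

/-- **(iii) is vacuous under the classical Heegner hypothesis.** If every prime dividing the conductor `N` of `E` splits in `K`
(`SatisfiesHeegnerHypothesis N K` [Gross 1991 §1; Darmon 2004 Hyp. 3.9]), then "`E` is nonsplit multiplicative at every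
multiplicative prime `q` not split in `K`" holds for want of such primes: a multiplicative `q` divides `N`
[Silverman 1994 IV.10.2(a); tree `dvd_conductorNorm_iff_not_hasGoodReductionAtPrime`], hence splits in `K`. Feeds the (iii)-binder of
`erratum_exists_frames_members_sigma_congruence_nonsplit` / `castella2020_thm211_members_frames_sigma_congruence_odd_nonsplit` at an
all-split `K`. [folklore] [cite: Castella2018Erratum, Thm. 1.1 hypothesis (iii) (arXiv:2409.01360 Thm. 1.3 (iii), p. 3)]
[cite: Silverman1994, IV.10.2(a)] -/
theorem erratum_hypothesis_iii_of_satisfiesHeegnerHypothesis (W : WeierstrassCurve ℚ) [W.IsElliptic] (K : Type) [Field K]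
    {N : ℕ} (hN : W.conductorNorm ℤ = N) (hH : SatisfiesHeegnerHypothesis N K) :
    ∀ (q : ℕ) [Fact q.Prime], Mult W q → ((Ideal.span {(q : ℤ)}).primesOver (𝓞 K)).ncard ≠ 2 →
      ¬ W.HasSplitMultiplicativeReductionAtPrime q := by
  intro q _ hq hne _
  refine hne (hH q Fact.out ?_)
  have h : q ∣ W.conductorNorm ℤ :=
    (W.dvd_conductorNorm_iff_not_hasGoodReductionAtPrime q).mpr
      (WeierstrassCurve.HasMultiplicativeReduction.not_hasGoodReduction (R := ℤ_[q]) hq)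
  rwa [hN] at h

/-- **(iii) from ONE nonsplit witness prime.** If every multiplicative prime of `E` that is not split in `K` equals a fixed prime
`q₀` (e.g. `K` Heegner for `N` with exactly one prime `q₀ ∥ N` ramified in `K` and all other primes of `N` split), and `E` is
NOT split multiplicative at `q₀`, then the (iii)-binder of the re-typed facts holds. Pure bookkeeping (no arithmetic input). [folklore]
[cite: Castella2018Erratum, Thm. 1.1 hypothesis (iii) (arXiv:2409.01360 Thm. 1.3 (iii), p. 3)] -/
theorem erratum_hypothesis_iii_of_forall_eq (W : WeierstrassCurve ℚ) (K : Type) [Field K] {q₀ : ℕ} [Fact q₀.Prime]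
    (hkey : ∀ (q : ℕ) [Fact q.Prime], Mult W q → ((Ideal.span {(q : ℤ)}).primesOver (𝓞 K)).ncard ≠ 2 → q = q₀)
    (hns : ¬ W.HasSplitMultiplicativeReductionAtPrime q₀) :
    ∀ (q : ℕ) [Fact q.Prime], Mult W q → ((Ideal.span {(q : ℤ)}).primesOver (𝓞 K)).ncard ≠ 2 →
      ¬ W.HasSplitMultiplicativeReductionAtPrime q := by
  intro q _ hq hne
  obtain rfl := hkey q hq hne
  convert hns

end Literature.NumberTheory.EllipticCurves.Castella2018

end
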